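/-
Copyright (c) 2026 the pub-hodgecm-mathlib formalisation cell (harness21).  Prover seat hodgecm-mathlib-LH4-p07 (g9), req620 Track A «(D-RAM) FOUR-FRAME» squad
(STAGE-1b, row-(2) lineage; dealer LH4-plan (g13) WORD #58 RULING A ∕ #59 ∕ #64 ∕ #65 ∕ #69 (4): owner of the two-literal census law of `lev_{a,m}`, RamK lane), 2026-09-04.
-/
import Summits.HodgeConjecture.HodgeConjecture.Theorems.F0P3cDyRamLevelsCensusLawArithRamK   -- ★ p859957 (this seat): `law_arith`, `sum_pow_add_eq_mul_sum`; brings `filter_band_eq_Ioc`, `StageOneBDefs`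
import HarnessLib

/-!
# Crux `H413`, line LH4 «(D-RAM) FOUR-FRAME» — STAGE-1b, row (2): (LAW-arith)-RamK-T «THE CLOSING ARITHMETIC FOR THE CLEAN PAIR `lev_{ℓ₀, m_c}`, `lev_{ℓ₀+1, m_c}`, TYPE RamK»
# `(q − 1)·q^{ks}·W(m₁, jl₁, C) = 2q^m(q^{(jλ−d)∕2+1} − q^{shiftR d + bs})`, `(ks, bs) = (sT, sT)` ∕ `(sT + 1, sT − 1)`

Cell `hodgecm-mathlib` (D-0151), FLOOR 0, crux item H413 = `stmt-HodgeConjecture-24833`, route of record `HCCMUnconditional`; squad F0∕P3c∕LH4; lane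
`--supports stmt-HodgeConjecture-24833 --as helper` (count-neutral; pays NO tier-0 row).  THEOREMS ONLY; pure `ℚ`∕`ℕ` bookkeeping.  Companion of ★ p859957
`F0P3cDyRamLevelsCensusLawArithRamK` (pieces of record `sq_{m*}`, `lev_{ℓ₀,m*}`, `lev_{ℓ₀+1,m*}`): dealer WORD #69 (4) asks the (LAW) END to serve FOUR instances — this file adds the
T₊ pair `lev_{ℓ₀, m_c}` ∕ `lev_{ℓ₀+1, m_c}` at the CLEAN square level `m_c = mcOfRecord d` (★ p859562), cutoff `C + m_c = m + jλ`:
* **`law_arith_levT_lo_even`** (even `d`, `a′ = ℓ₀ = 0`, standard lane) and **`law_arith_levT_lo_odd`** (odd `d`, `a′ = 1`, flipped lane): `(ks, bs) = (sTOfRecord d, sTOfRecord d)`;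
* **`law_arith_levT_hi_even`** (even `d`, `a′ = 1`, flipped lane) and **`law_arith_levT_hi_odd`** (odd `d`, `a′ = 2`, standard lane): `(ks, bs) = (sTOfRecord d + 1, sTOfRecord d − 1)`
— the dealer's D-1b letters `(sT, sT)`, `(sT + 1, sT − 1)` (★ p859562 `sTOfRecord` docstring), each an instance of ★ `law_arith` with the exponents discharged by `omega`
(general rule behind all eight corollaries: standard lane `ks = a′∕2 + ⌈b′∕2⌉ − ⌊d∕2⌋`, `bs = ks − a′`; flipped lane `ks = (a′+1)∕2 + ⌈b′∕2⌉ − ⌈d∕2⌉`, `bs = ks − a′ − 1 + 2(d%2)`).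
HONEST LABEL.  Count-neutral arithmetic; no frame, no CM place, no law asserted; `HC_CM` is proved only modulo the 7 printed citations (2 remaining named inputs: hLiu418 =
`stmt-HodgeConjecture-24832`, h413 = `stmt-HodgeConjecture-24833`) until rung 0 closes.

## References
* [Rogawski1990] J. D. Rogawski, *Automorphic Representations of Unitary Groups in Three Variables*, Ann. of Math. Stud. 123 (1990): §4.9 Prop. 4.9.1 (b) p. 55.
* [Kottwitz1986BaseChangeUnits] R. E. Kottwitz, *Base change for unit elements of Hecke algebras*, Compositio Math. 60 (1986): §1 pp. 240–241.
* [Flicker1998UnitaryFL] Y. Z. Flicker, *Elementary proof of the fundamental lemma for a unitary group*, Canad. J. Math. 50 (1998): Prop. 7 p. 84.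
-/

set_option autoImplicit false

namespace Summit.HodgeConjecture.HodgeConjecture.Cruxes.H413.F0P3cDyRamLevelsCensusLawArithRamKTransv

open Finset
open Summit.HodgeConjecture.HodgeConjecture.Cruxes.H413.F0P3cDyRamFourFramePieces (mstarOfRecord)
open Summit.HodgeConjecture.HodgeConjecture.Cruxes.H413.F0P3cDyRamStageOneBDefs (mcOfRecord sTOfRecord)
open Summit.HodgeConjecture.HodgeConjecture.Cruxes.H413.F0P3cDyRamToricCensusSumRamKCut (filter_band_eq_Ioc)
open Summit.HodgeConjecture.HodgeConjecture.Cruxes.H413.F0P3cDyRamLevelsCensusLawArithRamK (law_arith sum_pow_add_eq_mul_sum)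

/-- **CLOSING ARITHMETIC, `lev_{ℓ₀,m_c}` at EVEN `d`**: `a′ = 0`, standard lane, `(ks, bs) = (sT, sT)`; `C + m_c = m + jλ`. [cite: Rogawski1990, §4.9 Prop. 4.9.1 (b) p. 55] [cite: Flicker1998UnitaryFL, Prop. 7 p. 84] -/
theorem law_arith_levT_lo_even (q : ℕ) (hq : 2 ≤ q) {d m jl m₁ jl₁ C : ℕ} (hd : 2 ≤ d) (hde : d % 2 = 0)
    (hme : m₁ + 0 = m) (hjle : jl₁ + 0 = jl) (hjl : jl % 2 = d % 2) (hpar : m % 2 = d % 2) (hmjl : m ≤ jl)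
    (hCeq : C + mcOfRecord d = m + jl) (hC : jl₁ ≤ C) (hCe : C + d ≤ m₁ + jl₁ + 1)
    (hfar : m₁ + 2 * d ≤ C + 2) :
    ((q : ℚ) - 1) * (q : ℚ) ^ sTOfRecord d *
        ((q : ℚ) ^ m₁ * (2 * ∑ i ∈ range ((jl₁ - d) / 2 + 1), (q : ℚ) ^ i - 2 * ∑ i ∈ range (d - d % 2), (q : ℚ) ^ i) -
          2 * ∑ a ∈ (range (jl₁ + 2)).filter (fun a => a ≤ m₁ ∧ C + m₁ < jl₁ + 2 * a ∧ 2 * m₁ + 2 * d < jl₁ + 2 * a + 2 ∧ 2 * a + d ≤ 2 * m₁ + 1),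
            (q : ℚ) ^ (a + jl₁ / 2)) =
      2 * (q : ℚ) ^ m * ((q : ℚ) ^ ((jl - d) / 2 + 1) - (q : ℚ) ^ ((d - d % 2) + sTOfRecord d)) := by
  have hx : (q : ℚ) ≠ 1 := by exact_mod_cast (show q ≠ 1 by omega)
  have hms : mstarOfRecord d = d % 2 + 2 * d - 1 := rfl
  have hmc : mcOfRecord d = 2 * ((mstarOfRecord d + d) / 2) := rfl
  have hsT : sTOfRecord d = d - 1 + d % 2 := rfl
  rw [filter_band_eq_Ioc hd (by omega) hC hfar, sum_pow_add_eq_mul_sum, ← mul_assoc (2 : ℚ)]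
  exact law_arith (q : ℚ) hx (by omega) (by omega) (by omega) (by omega)

/-- **CLOSING ARITHMETIC, `lev_{ℓ₀,m_c}` at ODD `d`**: `a′ = 1`, flipped lane, `(ks, bs) = (sT, sT)`. [cite: Rogawski1990, §4.9 Prop. 4.9.1 (b) p. 55] [cite: Flicker1998UnitaryFL, Prop. 7 p. 84] -/
theorem law_arith_levT_lo_odd (q : ℕ) (hq : 2 ≤ q) {d m jl m₁ jl₁ C : ℕ} (hd : 2 ≤ d) (hdo : d % 2 = 1)
    (hme : m₁ + 1 = m) (hjle : jl₁ + 1 = jl) (hjl : jl % 2 = d % 2) (hpar : m % 2 = d % 2) (hmjl : m ≤ jl)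
    (hCeq : C + mcOfRecord d = m + jl) (hC : jl₁ ≤ C) (hCe : C + d ≤ m₁ + jl₁ + 1)
    (hfar : m₁ + 2 * d ≤ C + 2) :
    ((q : ℚ) - 1) * (q : ℚ) ^ sTOfRecord d *
        ((q : ℚ) ^ m₁ * (2 * ∑ i ∈ range ((jl₁ - d + 1) / 2 + d % 2), (q : ℚ) ^ i - 2 * ∑ i ∈ range (d - 1 + d % 2), (q : ℚ) ^ i) -
          2 * ∑ a ∈ (range (jl₁ + 2)).filter (fun a => a ≤ m₁ ∧ C + m₁ < jl₁ + 2 * a ∧ 2 * m₁ + 2 * d < jl₁ + 2 * a + 2 ∧ 2 * a + d ≤ 2 * m₁ + 1),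
            (q : ℚ) ^ (a + jl₁ / 2)) =
      2 * (q : ℚ) ^ m * ((q : ℚ) ^ ((jl - d) / 2 + 1) - (q : ℚ) ^ ((d - d % 2) + sTOfRecord d)) := by
  have hx : (q : ℚ) ≠ 1 := by exact_mod_cast (show q ≠ 1 by omega)
  have hms : mstarOfRecord d = d % 2 + 2 * d - 1 := rfl
  have hmc : mcOfRecord d = 2 * ((mstarOfRecord d + d) / 2) := rfl
  have hsT : sTOfRecord d = d - 1 + d % 2 := rfl
  rw [filter_band_eq_Ioc hd (by omega) hC hfar, sum_pow_add_eq_mul_sum, ← mul_assoc (2 : ℚ)]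
  exact law_arith (q : ℚ) hx (by omega) (by omega) (by omega) (by omega)

/-- **CLOSING ARITHMETIC, `lev_{ℓ₀+1,m_c}` at EVEN `d`**: `a′ = 1`, flipped lane, `(ks, bs) = (sT + 1, sT − 1)`. [cite: Rogawski1990, §4.9 Prop. 4.9.1 (b) p. 55] [cite: Flicker1998UnitaryFL, Prop. 7 p. 84] -/
theorem law_arith_levT_hi_even (q : ℕ) (hq : 2 ≤ q) {d m jl m₁ jl₁ C : ℕ} (hd : 2 ≤ d) (hde : d % 2 = 0)
    (hme : m₁ + 1 = m) (hjle : jl₁ + 1 = jl) (hjl : jl % 2 = d % 2) (hpar : m % 2 = d % 2) (hmjl : m ≤ jl)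
    (hCeq : C + mcOfRecord d = m + jl) (hC : jl₁ ≤ C) (hCe : C + d ≤ m₁ + jl₁ + 1)
    (hfar : m₁ + 2 * d ≤ C + 2) :
    ((q : ℚ) - 1) * (q : ℚ) ^ (sTOfRecord d + 1) *
        ((q : ℚ) ^ m₁ * (2 * ∑ i ∈ range ((jl₁ - d + 1) / 2 + d % 2), (q : ℚ) ^ i - 2 * ∑ i ∈ range (d - 1 + d % 2), (q : ℚ) ^ i) -
          2 * ∑ a ∈ (range (jl₁ + 2)).filter (fun a => a ≤ m₁ ∧ C + m₁ < jl₁ + 2 * a ∧ 2 * m₁ + 2 * d < jl₁ + 2 * a + 2 ∧ 2 * a + d ≤ 2 * m₁ + 1),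
            (q : ℚ) ^ (a + jl₁ / 2)) =
      2 * (q : ℚ) ^ m * ((q : ℚ) ^ ((jl - d) / 2 + 1) - (q : ℚ) ^ ((d - d % 2) + (sTOfRecord d - 1))) := by
  have hx : (q : ℚ) ≠ 1 := by exact_mod_cast (show q ≠ 1 by omega)
  have hms : mstarOfRecord d = d % 2 + 2 * d - 1 := rfl
  have hmc : mcOfRecord d = 2 * ((mstarOfRecord d + d) / 2) := rfl
  have hsT : sTOfRecord d = d - 1 + d % 2 := rfl
  rw [filter_band_eq_Ioc hd (by omega) hC hfar, sum_pow_add_eq_mul_sum, ← mul_assoc (2 : ℚ)]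
  exact law_arith (q : ℚ) hx (by omega) (by omega) (by omega) (by omega)

/-- **CLOSING ARITHMETIC, `lev_{ℓ₀+1,m_c}` at ODD `d`**: `a′ = 2`, standard lane, `(ks, bs) = (sT + 1, sT − 1)`. [cite: Rogawski1990, §4.9 Prop. 4.9.1 (b) p. 55] [cite: Flicker1998UnitaryFL, Prop. 7 p. 84] -/
theorem law_arith_levT_hi_odd (q : ℕ) (hq : 2 ≤ q) {d m jl m₁ jl₁ C : ℕ} (hd : 2 ≤ d) (hdo : d % 2 = 1)
    (hme : m₁ + 2 = m) (hjle : jl₁ + 2 = jl) (hjl : jl % 2 = d % 2) (hpar : m % 2 = d % 2) (hmjl : m ≤ jl)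
    (hCeq : C + mcOfRecord d = m + jl) (hC : jl₁ ≤ C) (hCe : C + d ≤ m₁ + jl₁ + 1)
    (hfar : m₁ + 2 * d ≤ C + 2) :
    ((q : ℚ) - 1) * (q : ℚ) ^ (sTOfRecord d + 1) *
        ((q : ℚ) ^ m₁ * (2 * ∑ i ∈ range ((jl₁ - d) / 2 + 1), (q : ℚ) ^ i - 2 * ∑ i ∈ range (d - d % 2), (q : ℚ) ^ i) -
          2 * ∑ a ∈ (range (jl₁ + 2)).filter (fun a => a ≤ m₁ ∧ C + m₁ < jl₁ + 2 * a ∧ 2 * m₁ + 2 * d < jl₁ + 2 * a + 2 ∧ 2 * a + d ≤ 2 * m₁ + 1),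
            (q : ℚ) ^ (a + jl₁ / 2)) =
      2 * (q : ℚ) ^ m * ((q : ℚ) ^ ((jl - d) / 2 + 1) - (q : ℚ) ^ ((d - d % 2) + (sTOfRecord d - 1))) := by
  have hx : (q : ℚ) ≠ 1 := by exact_mod_cast (show q ≠ 1 by omega)
  have hms : mstarOfRecord d = d % 2 + 2 * d - 1 := rfl
  have hmc : mcOfRecord d = 2 * ((mstarOfRecord d + d) / 2) := rfl
  have hsT : sTOfRecord d = d - 1 + d % 2 := rfl
  rw [filter_band_eq_Ioc hd (by omega) hC hfar, sum_pow_add_eq_mul_sum, ← mul_assoc (2 : ℚ)]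
  exact law_arith (q : ℚ) hx (by omega) (by omega) (by omega) (by omega)

end Summit.HodgeConjecture.HodgeConjecture.Cruxes.H413.F0P3cDyRamLevelsCensusLawArithRamKTransv
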